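import Summits.BirchSwinnertonDyer.BirchSwinnertonDyer.Theorems.ManinLocalTwoThreeTranslationNewform
import Literature.NumberTheory.EllipticCurves.AtkinLehnerInvolutionsProofs
import Literature.NumberTheory.EllipticCurves.AtkinLehnerProductProofs
import HarnessLib

/-!
# The Conway lattice satisfies the four Katz–Mazur cusp conditions: `S^G ≤ L₄` (`4 ∣ N`) — the easy half of E-imc-128 / E-desc-33

Summit `BirchSwinnertonDyer`, sub-problem `BirchSwinnertonDyer`, route `ManinLocalTwoThree`; width seat `bsd-line-manin23-p2`
(gen 9), `--supports` the crux C2 `ManinOddAtFour` (stmt-BirchSwinnertonDyer-22967).  Cell `bsd-f2-manin`: desc g5's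
`ConwayCut.conwayStableLattice` (`S^G`, the largest integral `⟨w_{Q_p}, t⟩`-stable lattice) and `ConwayCut.kmCuspLattice`
(`L₄ = S ∩ wS ∩ twS ∩ wtwS`, integrality at the cusp classes `∞, 0, ½, w(½)`); imc g18 E-imc-128
`ConwayEqKatzMazurCuspLatticeAtTwo` / desc E-desc-33 assert the HARD half `L₄ ≤₂ S^G` on the reduced cells.  This file
proves the EASY half unconditionally, so that those rows become 2-adic EQUALITIES once proved.

* `atkinLehnerInvolutionAt_atkinLehnerInvolutionAt` — `w_{Q_q}² = 1` (tree, Knapp 9.24, respelled);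
* `halfTranslate_halfTranslate_two` — `t² = 1` at weight `2`, `4 ∣ N` (`q`-expansions: `((−1)ⁿ)² = 1`);
* **`conwayStableLattice_le_kmCuspLattice`** — `S^G ≤ L₄` for `4 ∣ N`.

Elementary.  BSD is not proved by this; Manin's conjecture is not proved by this.
-/

set_option autoImplicit false
set_option linter.dupNamespace false

noncomputable section

open scoped MatrixGroups ModularForm
open CongruenceSubgroup
open Literature.NumberTheory.EllipticCurves Literature.NumberTheory.EllipticCurves.ModularForms
open Summit.BirchSwinnertonDyer.Rank1Residual.ManinAdditive
open Summit.BirchSwinnertonDyer.Rank1Residual.ManinAdditive.ConwayCut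

namespace Summit.BirchSwinnertonDyer.BirchSwinnertonDyer.Theorems.ManinLocalTwoThree

variable {N : ℕ} [NeZero N]

/-- `w_{Q_q} (w_{Q_q} f) = f` for a prime `q ∣ N` (tree `atkinLehnerInvolution_atkinLehnerInvolution`). -/
theorem atkinLehnerInvolutionAt_atkinLehnerInvolutionAt {k : ℤ} {q : ℕ} (hq : q.Prime) (hqN : q ∣ N)
    (f : CuspForm (Gamma0 N) k) :
    atkinLehnerInvolutionAt N k q (atkinLehnerInvolutionAt N k q f) = f := by
  haveI : NeZero (q ^ N.factorization q) := ⟨(Nat.ordProj_pos N q).ne'⟩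
  obtain ⟨hQN, hcQ⟩ := ordProj_dvd_and_coprime N (Nat.mem_primeFactors.mpr ⟨hq, hqN, NeZero.ne N⟩)
  rw [atkinLehnerInvolutionAt_eq (N := N) (k := k) (p := q) rfl]
  exact atkinLehnerInvolution_atkinLehnerInvolution N k (q ^ N.factorization q) hQN hcQ f

/-- `t (t f) = f` at weight `2`, `4 ∣ N` (`aₙ ↦ (−1)ⁿ aₙ` twice). -/
theorem halfTranslate_halfTranslate_two (h4 : 4 ∣ N) (f : CuspForm (Gamma0 N) 2) :
    halfTranslate N 2 (halfTranslate N 2 f) = f := by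
  refine eq_of_forall_cuspCoeff_eq_gamma0 fun n => ?_
  rw [cuspCoeff_halfTranslate_two h4, cuspCoeff_halfTranslate_two h4, ← mul_assoc, ← mul_pow]
  norm_num

/-- **`S^G ≤ L₄`** (`4 ∣ N`): every element of the Conway lattice is integral at `∞`, and so are its transforms by `w`,
`t w`, `w t w` (`w = w_{Q_2}`, `t` the half-translation), because `S^G` is `w`- and `t`-stable and `w² = t² = 1`. -/
theorem conwayStableLattice_le_kmCuspLattice (h4 : 4 ∣ N) : conwayStableLattice N ≤ kmCuspLattice N := by
  have h2N : 2 ∣ N := (show (2 : ℕ) ∣ 4 by norm_num).trans h4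
  have hS : conwayStableLattice N ≤ integralCuspForms0 N 2 := conwayStableLattice_le
  have hw : ∀ y ∈ conwayStableLattice N, atkinLehnerInvolutionAt N 2 2 y ∈ conwayStableLattice N := by
    intro y hy
    have h : (conwayStableLattice N).map ((atkinLehnerInvolutionAt N 2 2).restrictScalars ℤ) ≤ conwayStableLattice N := by
      unfold conwayStableLattice
      rw [Submodule.map_le_iff_le_comap]
      exact sSup_le fun M hM => Submodule.map_le_iff_le_comap.mp ((hM.2.1 2 Nat.prime_two h2N).trans (le_sSup hM))
    exact h ⟨y, hy, rfl⟩
  have ht : ∀ y ∈ conwayStableLattice N, halfTranslate N 2 y ∈ conwayStableLattice N := by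
    intro y hy
    have h : (conwayStableLattice N).map ((halfTranslate N 2).restrictScalars ℤ) ≤ conwayStableLattice N := by
      unfold conwayStableLattice
      rw [Submodule.map_le_iff_le_comap]
      exact sSup_le fun M hM => Submodule.map_le_iff_le_comap.mp (hM.2.2.trans (le_sSup hM))
    exact h ⟨y, hy, rfl⟩
  have hww : ∀ y : CuspForm (Gamma0 N) 2, atkinLehnerInvolutionAt N 2 2 (atkinLehnerInvolutionAt N 2 2 y) = y :=
    fun y => atkinLehnerInvolutionAt_atkinLehnerInvolutionAt Nat.prime_two h2N y
  have htt : ∀ y : CuspForm (Gamma0 N) 2, halfTranslate N 2 (halfTranslate N 2 y) = y :=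
    fun y => halfTranslate_halfTranslate_two h4 y
  -- membership in the `map`s: `x = w (w x)`, `x = t (t x)`
  have hmw : ∀ y ∈ conwayStableLattice N,
      y ∈ (integralCuspForms0 N 2).map ((atkinLehnerInvolutionAt N 2 2).restrictScalars ℤ) :=
    fun y hy => ⟨atkinLehnerInvolutionAt N 2 2 y, hS (hw y hy), hww y⟩
  have hmtw : ∀ y ∈ conwayStableLattice N,
      y ∈ ((integralCuspForms0 N 2).map ((atkinLehnerInvolutionAt N 2 2).restrictScalars ℤ)).map
        ((halfTranslate N 2).restrictScalars ℤ) :=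
    fun y hy => ⟨halfTranslate N 2 y, hmw _ (ht y hy), htt y⟩
  intro x hx
  unfold kmCuspLattice
  simp only [Submodule.mem_inf]
  exact ⟨⟨⟨hS hx, hmw x hx⟩, hmtw x hx⟩, ⟨atkinLehnerInvolutionAt N 2 2 x, hmtw _ (hw x hx), hww x⟩⟩

end Summit.BirchSwinnertonDyer.BirchSwinnertonDyer.Theorems.ManinLocalTwoThree

end
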